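import Mathlib
import Summits.KontsevichZagierPeriods.KontsevichZagierPeriods.Theses.SymplecticScissors
import Literature.NumberTheory.Transcendental.KZCalculusProofs

/-!
# `VolumeForm` (stmt-KontsevichZagierPeriods-3814), line `Sketch` — stub `stub_coneSector`

The CONE SECTOR of the ruled-stacks line ("Democritus' cones in `ℝ³` are decided by the planar
layer"), as pure glue. Hypotheses: (i) *cone flattening* (all `n`) — the open cone
`{p | 0 < p_last < 1, (p_i / p_last)_i ∈ K}` over an integrand-`1` base `K ⊂ ℝⁿ⁺¹` (integrand `1`)
is KZ-equivalent to an integrand-`1` planar copy `K'` of `K` squeezed by the factor `n + 2` in the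
first coordinate, and such a `K'` exists; (ii) the planar layer `PlanarAreas` (stmt-4990): two
planar integrand-`1` representations with the same value are KZ-equivalent. Conclusion: two open
cones in `ℝ³` (over planar integrand-`1` bases) of equal volume are KZ-equivalent.

Proof: flatten both cones `C₁ ↝ K₁'`, `C₂ ↝ K₂'` (instance `n := 1`); by soundness of the calculus
(`KZ.Equivalent.value_eq_holds`) `K₁'.value = C₁.value = C₂.value = K₂'.value`, so `K₁' ∼ K₂'` by
`PlanarAreas`, and `C₁ ∼ K₁' ∼ K₂' ∼ C₂` by transitivity/symmetry of `KZ.Equivalent`.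

Sources: M. Kontsevich, D. Zagier, *Periods* (2001), §1.2 (rules (1)–(3), soundness); the cone
volume `(1/3) · base · height` is Democritus/Archimedes; the rest is bookkeeping (folklore).
-/

noncomputable section

open Set MeasureTheory
open Literature.NumberTheory.Transcendental

namespace Summit.KontsevichZagierPeriods.SymplecticScissors.VolumeForm

open Summit.KontsevichZagierPeriods.KontsevichZagierPeriods.Theses.SymplecticScissors (PlanarAreas)

/-- **Cone sector** (glue): given cone flattening (every open cone over an integrand-`1` base is
KZ-equivalent to a squeezed planar copy of its base) and the planar layer `PlanarAreas`
(stmt-4990), two open cones in `ℝ³` of equal volume are KZ-equivalent (flatten both, compare the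
two planar copies by `PlanarAreas` — their values agree by soundness
`KZ.Equivalent.value_eq_holds` — and chain by transitivity). [Kontsevich–Zagier 2001, §1.2;
Democritus/Archimedes; folklore] -/
theorem stub_coneSector :
    (∀ (n : ℕ) (K : KZ.IntegralRep (n + 1)) (C : KZ.IntegralRep (n + 2)),
      (∀ x ∈ K.domain, K.integrand x = 1) →
      C.domain = {p | 0 < p (Fin.last (n + 1)) ∧
        (fun i : Fin (n + 1) => p (Fin.castSucc i) / p (Fin.last (n + 1))) ∈ K.domain ∧
        p (Fin.last (n + 1)) < 1} →
      (∀ p ∈ C.domain, C.integrand p = 1) →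
      ∃ K' : KZ.IntegralRep (n + 1),
        K'.domain = {u | Function.update u 0 (((n : ℝ) + 2) * u 0) ∈ K.domain} ∧
        (∀ u ∈ K'.domain, K'.integrand u = 1) ∧ KZ.Equivalent C K') →
    PlanarAreas →
    ∀ (K₁ K₂ : KZ.IntegralRep 2) (C₁ C₂ : KZ.IntegralRep 3),
      (∀ x ∈ K₁.domain, K₁.integrand x = 1) → (∀ x ∈ K₂.domain, K₂.integrand x = 1) →
      C₁.domain = {p | 0 < p (Fin.last 2) ∧
        (fun i : Fin 2 => p (Fin.castSucc i) / p (Fin.last 2)) ∈ K₁.domain ∧ p (Fin.last 2) < 1} →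
      C₂.domain = {p | 0 < p (Fin.last 2) ∧
        (fun i : Fin 2 => p (Fin.castSucc i) / p (Fin.last 2)) ∈ K₂.domain ∧ p (Fin.last 2) < 1} →
      (∀ p ∈ C₁.domain, C₁.integrand p = 1) → (∀ p ∈ C₂.domain, C₂.integrand p = 1) →
      C₁.value = C₂.value → KZ.Equivalent C₁ C₂ := by
  intro hCF hP K₁ K₂ C₁ C₂ h1 h2 hC₁ hC₂ hc1 hc2 hv
  obtain ⟨K₁', _hd₁, h1', hCK₁⟩ := hCF 1 K₁ C₁ h1 hC₁ hc1
  obtain ⟨K₂', _hd₂, h2', hCK₂⟩ := hCF 1 K₂ C₂ h2 hC₂ hc2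
  have hv₁ : C₁.value = K₁'.value := KZ.Equivalent.value_eq_holds hCK₁
  have hv₂ : C₂.value = K₂'.value := KZ.Equivalent.value_eq_holds hCK₂
  have hKv : K₁'.value = K₂'.value := by rw [← hv₁, ← hv₂, hv]
  have hKK : KZ.Equivalent K₁' K₂' := hP K₁' K₂' h1' h2' hKv
  exact hCK₁.trans (hKK.trans hCK₂.symm)

end Summit.KontsevichZagierPeriods.SymplecticScissors.VolumeForm

end
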